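import Literature.MathematicalPhysics.QuantumFieldTheory.Volkov2017.SamplingDegree
import Literature.MathematicalPhysics.QuantumFieldTheory.Volkov2024.SamplingDegreePositivity2024
import Mathlib.Tactic.NormNum
import Mathlib.Tactic.Linarith
import Mathlib.Tactic.FinCases
import HarnessLib

/-!
# Volkov's 2024 sampling exponent Deg₀(s) (PRD 110, 036001 §IV.B.2–3) for graphs without lepton loops — the graph-dependent construction (ω̄, chains / Ch, ω̃, ω̃′, D_F's argument, the 𝔉_max-minimum and the «big-set» branch) typed as computable functions, and EVERY printed worked number of the paper's no-lepton-loop example (FIG. 2) certified by `decide`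

independent recomputation; certified where stated, statistical where stated; no new-physics claim.

CITATION HEADER (venture `QEDPrecision`, cell `pub-qed`, track TROPICAL seat V3b = `pub-qed-trop-v3-lit-2` gen 7; VALUE-FREE: graph
combinatorics, the printed definitions, the printed sampler constants and the printed worked examples only — no integral, no Monte-Carlo
value, nothing per Set V family or word). Serves `tropical/view/V3-VOLKOV-DEGREES.md` §B.5 (the 2024 density AS PRINTED), §B.6 (its Set V
specialisation, «checked against Volkov's own FIG. 2 worked numbers») and §B.25; completes the Deg family of the tree: PRD 96 / PRD 98
(`Volkov2017.Gr.deg17`, `Gr.deg18`, lit g21), the 2024 CONSTANTS, μ, τ and TABLE V (`Volkov2024.SamplingDensityParameters`, lit g21) and the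
2024 BRANCH bounds (`Volkov2024.SamplingDegreePositivity2024`, V3b g6) — this file adds the 2024 forest recursion itself.

Source [Volkov2024] S. Volkov, "Calculation of the total 10th order QED contribution to the electron magnetic moment", Phys. Rev. D 110,
036001 (2024) = arXiv:2404.00649v2, §IV.B.2 "Auxiliary functions" and §IV.B.3 "The formula" (LaTeX e-print `amm5_a1_all.tex` held by the
cell, HOME `pub-qed-trop-v3-lit-2/sources/arxiv-2404.00649/`, tex l.528–1219; arXiv PDF p.10–21). VERBATIM (tex line numbers):
* (l.546–552) "A subgraph G′ of a graph G is said to lie on LPath[G], if G′ has external lepton lines, and each of these lines is in LPath[G]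
  or coincides with an external line of G. A set s ⊆ Edge[G] is called cyclo-complete, if (Lept(Edge[G]) ∖ LPath[G]) ⊆ s."
* (l.558–561) "ω_G(s) = 2 × Loop(s) − |s| + ½|Lept(s)|" · (l.575–577) "If F ∈ 𝔉[G] and G′ ∈ F, then by G′/F we denote the graph that is
  obtained from G′ by shrinking all children of G′ in F to points. … we really apply it to the set s′ that is the intersection of s and the
  set of all internal lines of G′/F."
* (l.597–617) "Let us define ω̄_G(s) … The set s ∩ LPath[G] can be considered as a union of nonintersecting paths. Suppose I₁, …, I_l are
  the sets of vertices corresponding to these paths … I₀ = LPath[G] ∖ (I₁ ∪ … ∪ I_l). We say that two vertices v₁, v₂ from Vertex(LPath[G])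
  are 1-equivalent, if there is a path in Edge[G] ∖ LPath[G] from v₁ to v₂ … B₁, …, B_r are classes of equivalence … 2-equivalent, if
  there is a path in s ∖ LPath[G] from v₁ to v₂ … By N_{jb} we denote the number of equivalence classes in I_j ∩ B_b with respect to
  2-equivalence (the number is 0 if the set is empty). a_{jb} = 1 if 0 < N_{jb} < Σ_{i=0}^{l} N_{ib}; ½ if 1 = N_{jb} = Σ_{i=0}^{l} N_{ib};
  0 in the other cases. ω̄_G(s) = 2 × Loop(s) − |s| + ½|Lept(s) ∖ LPath[G]| + ½ Σ_{j=1}^{l} |I_j| + ½ Σ_{j=1}^{l} Σ_{b=1}^{r} N_{jb} −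
  Σ_{j=1}^{l} Σ_{b=1}^{r} a_{jb} − ½."
* (l.836–845) "The sequence (l₁, G₁, l₂, …, G_n, l_{n+1}), where n ≥ 1, G₁, …, G_n are self-energy subgraphs of G, l₁, …, l_{n+1} ∈ Edge[G],
  is called a chain in G, if: Vertex[G₁], …, Vertex[G_n] do not intersect; l₁, …, l_{n+1} are pairwise different; for all i, each of the lines
  l_i, l_{i+1} is incident to at least one vertex of Vertex[G_i]; the set {l₁, …, l_{n+1}} is maximal with respect to inclusion … Chains can
  be leptonic or photonic … the chain lies on LPath[G], if l₁, …, l_{n+1} ∈ LPath[G]." · (l.862) "by Ch[G′,F] we denote the set of all chains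
  (l₁, G₁, …, l_{n+1}) in G such that each G_i is a child of G′ in F." · (l.879–900) "Ch_{G′,F}(s) = Σ_{c∈Ch[G′,F]} g(c,s), g = f̄(c,s) if c is a
  fermionic chain, c lies on LPath[G], s is cyclo-complete in G … f̄((l₁,G₁,…,l_{n+1}), s) = −n/2 if l₁, …, l_{n+1} ∈ s; 0 otherwise."
* (l.1007–1030) "ω̃_{G′,F}(s) = max(ω̄_{G′/F}(s), ω_{G′/F}(s)) − Ch_{G′,F}(s), if s is cyclo-complete in G, and G′ lies on LPath[G];
  ω_{G′/F}(s) − Ch_{G′,F}(s) otherwise. ω̃′_{G′,F}(s) = min(0, ω̃_{G′,F}(s) + C_Sub[G′,s]), C_Sub[G′,s] = C_SubLSEOP(s) if G′ is a lepton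
  self-energy subgraph, G′ lies on LPath[G]; … C_SubI(s) if G′ is vertexlike, G′ lies on LPath[G], the external photon of G is incident to
  some v ∈ Vertex[G′]; C_SubVOP(s) if G′ is vertexlike, G′ lies on LPath[G], there is no v ∈ Vertex[G′] incident to the external photon of
  G; …" (TABLE V = `Volkov2024.tableV`).
* (l.1141–1177) "By 𝔉_max[G] we denote the set of all maximal sets from 𝔉[G] … Deg₀(s) = C_BigZ + (C_BigF − C_BigZ)·|Ph(s)|/|Ph(Edge[G])|,
  if Lept(Edge[G]) ⊆ s, and there exists F ∈ 𝔉_max[G] such that ω̃_{G′,F}(s) ≥ 0 for all G′ ∈ F; min_{F∈𝔉_max[G]} D_F(s) otherwise, where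
  D_F(s) = τ(−Σ_{G′∈F} ω̃′_{G′,F}(s), C_Add(s), C_Sat(s)) … μ(t) is a smooth approximation for 2 + max(0, 2t); the function τ(x, C_a, C_s)
  is a smooth approximation for max(x, C_s) + C_a." (μ, τ = `Volkov2024.mu`, `Volkov2024.tau`).
THE PRINTED NO-LEPTON-LOOP EXAMPLE, FIG. 2 `fig_example_noloops` "Example of a Feynman graph without lepton loops" (EPS in the e-print;
lepton path a-b-c-d-e-f-g-h-i, external photon at g, lepton lines 1…8 in path order, photons 9 = ce, 10 = df, 11 = bh, 12 = ai — this
transcription, `figNoLoops`, is CHECKED by the fact that every printed worked number below comes out right — one flagged intermediate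
excepted, which does not propagate): (l.562–567) "ω_G({1,…,11}) =
6 − 11 + 4 = −1, ω_G({1,3,4,5,8,9,10,11,12}) = 6 − 9 + 2.5 = −0.5"; (l.579–593) "the UV-divergent subgraphs are G₁ = bcdefgh, G₂ = cdef,
G₃ = cde, G₄ = def … F = {G, G₁, G₂, G₃} … ω_{G₁/F}({1,…,11}) = ω_{G₁/F}({2,6,7,11}) = 2 − 4 + 1.5 = −0.5 (G₂ is the only child of G₁ in F)";
(l.1078–1110, eqs. (10)–(11): F₁ = {G,G₁,G₂,G₃}, F₂ = {G,G₁,G₂,G₄}) "If s = {4,5,10,11}, we have ω̃_{G,F₁}(s) = ω̃_{G,F₂}(s) = 0, …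
ω̃_{G₁,F₁}(s) = ω̃_{G₁,F₂}(s) = max(ω̄_{G₁,F₁}(s), ω_{G₁,F₁}(s)) = max(−1.5, −1) = −1, … ω̃_{G₂,F₁}(s) = max(0.5, −0.5) = 0.5, …
ω̃_{G₂,F₂}(s) = max(−0.5, 0) = 0, … ω̃_{G₃,F₁}(s) = max(−1, −0.5) = −0.5, … ω̃_{G₄,F₂}(s) = max(0, 0) = 0"; (l.1180–1205) "𝔉_max[G] =
{F₁, F₂} … If s = {4,5,10,11} … Since all the constants C_SubLSEOP, …, C_SubVOL are nonnegative, we have Deg₀(s) = τ(max(0, 1 − C_SubI(s)),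
C_Add(s), C_Sat(s)). If s = {4,5,10}, we have ω̃_{G,F₂}(s) = ω̃_{G₁,F₂}(s) = ω̃_{G₂,F₂}(s) = ω̃_{G₄,F₂}(s) = 0, but we still use D_F, because
s does not contain Lept(Edge[G]): Deg₀(s) = D_{F₂}(s) = τ(0, C_Add(s), C_Sat(s)). If s = {1,2,3,4,5,6,7,8,10}, we have ω̃_{G,F₂}(s) = 0,
ω̃_{G₁,F₂}(s) = 0, ω̃_{G₂,F₂}(s) = 0.5, ω̃_{G₄,F₂}(s) = 0, Deg₀(s) = ¼ C_BigF + ¾ C_BigZ."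

MODEL (READING (V3b) of the printed definitions for vertexlike graphs WITHOUT lepton loops = every Set V (word, insertion) graph; this
is the `Volkov2017.Gr` model of lit g21 — lepton path 0 … nv−1, `ext` the external-photon vertex, UV-divergent subgraphs = 1PI vertex
intervals with ≤ 1 external photon, derived graphs `Gr.der I F` with a child represented by its least vertex, forests `Gr.maxForests`):
(M1) SPECIALISATION. Without lepton loops Lept(Edge[G]) = LPath[G], so EVERY s is cyclo-complete, the external photon is «on path»,
  every UV-divergent subgraph is a lepton self-energy or vertexlike subgraph lying on LPath[G], every chain is leptonic and lies on
  LPath[G], and ½|Lept(s) ∖ LPath| = 0; hence ω̃ always takes its FIRST case, g = f̄ always, and C_Sub[G′,s] ∈ {C_SubLSEOP, C_SubI,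
  C_SubVOP} (TABLE V column «cyclo-complete, on path»: 0, 0, 0.085; C_BigZ 0.695, C_BigF 0.285, C_Add 0.199, C_Sat 0.46 = `colPath`,
  `cBigZ 0`, `cBigF 0`, `cAdd 0`, `cSat 0`). The three sub-constants are kept as parameters (`SubConsts`) so that the printed symbolic
  conclusions («τ(max(0, 1 − C_SubI(s)), …)») are theorems for all nonnegative values; `Gr.dSub` (PRD 98's D_sub case split I-type /
  self-energy / other vertexlike, lit g21) IS the printed C_Sub case split restricted to these three cases.
  -- TODO(general form): graphs with lepton loops (ω̄'s ½|Lept(s)∖LPath| term on loop lines, the f / f̃ / p / p̃ chain functions, photon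
  -- self-energy and light-by-light subgraphs, TABLE V columns 2–4) are outside this model, as are all of the paper's FIG. 3–7 examples.
(M2) CHAINS. The lines l₁, …, l_{n+1} of a chain are read — as in every printed example (l.848–875: (1,G₁,3) for G₁ = bc, etc.) and in
  PRD 96 §III.B's wording «electron self-energy subgraphs and lines joining them form chains» — as the lepton lines ADJOINING the
  self-energy subgraphs from outside; Ch[G′,F] is computed from the self-energy CHILDREN of G′ in F as the maximal runs of abutting ones
  (`runs`, `chains`). For F ∈ 𝔉_max[G] (the only forests Deg₀ uses) this is the printed «chains in G such that each G_i is a child of G′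
  in F»: in a graph without lepton loops no 1PI subgraph contains the lepton line joining two abutting self-energy subgraphs without
  containing both, and no UV-divergent subgraph overlaps a self-energy subgraph, so abutting self-energy subgraphs are sibling children of
  one parent in every maximal forest (the two combinatorial facts are PROVED abstractly at the end of this file — `noCross_left` /
  `noCross_right`, `superinterval_margins`, `abutting_blocks_inside` — and the identification is checked on the printed examples, and
  against PRD 96's whole-graph SE-chains 𝔖[G] on its FIG. 3 / FIG. 5 in `chains_vs_seChains2017`). A run whose end member adjoins an EXTERNAL lepton line of G keeps only its internal
  joining lines (the printed definition asks l₁, …, l_{n+1} ∈ Edge[G]; the case cannot occur in a graph G(w, j) of a 1PI self-energy word).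
(M3) 1- and 2-EQUIVALENCE classes are connected classes of Vertex(LPath[G′/F]) under the photon lines of G′/F (resp. those in s), by the
  union-find `Volkov2017.mergeComp` of lit g21 seeded with all path vertices (`classesOn`); I₁ … I_l are the vertex sets of the connected
  components of s ∩ LPath[G′/F] (`Volkov2017.components`); N_{jb} counts the 2-classes met by I_j ∩ B_b.
(M4) The K = 3n − 1 merging of the two lepton lines at the external vertex (§IV.A «we use a trick to reduce the number from 3n to 3n−1»)
  is a property of the sampler's variables, not of Deg₀: the printed examples evaluate ω, ω̄, ω̃, Deg₀ on subsets of the twelve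
  UNMERGED line numbers of FIG. 2, and so does this file.
(M5) τ is real-valued (√), so Deg₀ itself is `noncomputable` (`deg0`); everything graph-dependent is computable over ℚ (`dfArg` = the
  argument −Σ ω̃′ of D_F, `deg0Arg` = its minimum over 𝔉_max, `bigCase` = the branch test, `phFrac`), and `deg0_of_not_bigCase` shows
  min_F τ(X_F) = τ(min_F X_F) from the monotonicity of τ (`tau_strictMono`) — the step the paper uses silently in «Since all the
  constants … are nonnegative, we have Deg₀(s) = τ(max(0, 1 − C_SubI(s)), …)».

WHAT THE KERNEL CERTIFIES. (A) On FIG. 2 (`figNoLoops`), by `decide`: the UV-divergent subgraphs {G₁ I-type, G₂ self-energy, G₃, G₄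
vertexlike, G₃/G₄ overlapping} and 𝔉_max[G] = {F₁, F₂} (`figNoLoops_forests`); ω_G = −1, −½ and Edge[G₁/F₁] = {2,6,7,11},
ω_{G₁/F₁} = −½ (`figNoLoops_omega`); at s = {4,5,10,11} the four printed (ω̄, ω) pairs and all six printed ω̃ (`figNoLoops_s1_F1`,
`figNoLoops_s1_F2`), with ONE printed intermediate NOT reproduced and flagged: the paper prints ω_{G₂/F₁}({4,5,10,11}) = −0.5 inside
«max(0.5, −0.5) = 0.5», the model gives +½ (in G₂/F₁ = cdef with cde shrunk, lines 5 and 10 both join the shrunk point to f: Loop = 1,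
2·1 − 2 + ½ = ½) — ω̄ = ½, the maximum ½ and every printed downstream value are unaffected (`figNoLoops_flagged_intermediate`; V3 NOTES
§B.6.5 had flagged it from a Python reading — DERIVED-EXACT here, for T1 to re-derive independently, not silently adopted either way);
Ch[G₁,F] = {(2, G₂, 6)} with f̄ = −½ exactly when 2, 6 ∈ s (`figNoLoops_chains`); at s = {4,5,10} and s = {1,…,8,10} the eight printed ω̃
(`figNoLoops_s2`, `figNoLoops_s3`); and the three printed Deg₀ conclusions for ALL nonnegative sub-constants and all C_Add + C_Sat > 0:
Deg₀({4,5,10,11}) = τ(max(0, 1 − C_SubI)), Deg₀({4,5,10}) = D_{F₂} = τ(0), Deg₀({1,…,8,10}) = ¼C_BigF + ¾C_BigZ (`figNoLoops_deg0_s1`,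
`_s2`, `_s3`), plus their TABLE-V column-1 instances (`figNoLoops_deg0SetV`). (B) In general (every `Gr`, every s): `tau_strictMono`;
`dfArg_nonneg` (−Σω̃′ ≥ 0), `deg0Arg_nonneg`; `maxForests_ne_nil`; `deg0_of_not_bigCase` (off the big-set branch Deg₀ = τ(min_F X_F));
`phFrac_nonneg`, `phFrac_le_one`; and `deg0_pos`: with the printed TABLE V constants of either cyclo-complete column Deg₀(s) > 0 for every
graph of the model and every line set — §IV.A's «Deg₀(s) are arbitrary positive real numbers» holds BY CONSTRUCTION (V3b g6's branch
bounds `DF_pos` / `bigBranch_printed_pos` assembled with the recursion). (C) CONCORDANCE 2017 ↔ 2024 on PRD 96's own example graphs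
(`chains_vs_seChains2017`): on FIG. 5 (`Volkov2017.figChains`) the 2024 chains of (G, F = {G,bc,de,gh,ij}) are PRD 96's SE-chains
𝔖[G] = {{1,3,5},{6,8,10}} with their members, and −Ch_{G,F}(s) = ω*_{G/F}(s) − ω′_{G/F}(s) = ½Σ(|s′| − 1) on the printed sets (2, 1, 0);
likewise on FIG. 3 (`figSelect`, chain (2, cdef, 9), ½). (D) (M2)'s STRUCTURAL FACTS as abstract theorems on a lepton path with a photon
relation (1PI = every cut bridged; self-energy block = photon-closed interval): a photon-closed block is never crossed by a 1PI interval
(`noCross_left`, `noCross_right`), a 1PI interval containing a photon-closed block has strict margins on both sides (`superinterval_margins`),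
and one containing the joining line of two abutting blocks contains both (`abutting_blocks_inside`); FIG. 2 instance `figNoLoops_seBlock_facts`.
(E) `ahknGraph w k` — the vertex graph of ANY q-type self-energy word w (AHKN: one open lepton line, 2n vertices, n photons) with the external
photon in lepton line k, in the `Gr` model; `ahknGraph_fig2`: FIG. 2 is the word abcdcdba at k = 6 and the printed forests / three Deg₀ cases
come out again; `x086_named_faces`: on AHKN's X086 = abaccdedbe the τ-arguments of the named Hepp faces (self-energy block cc, vertexlike
block ded, SE-chain face, single lines, all-lepton corners) at k = 2 and k = 4 — a kernel cross-check of the cell's Python table of the same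
rule (V3 NOTES §B.15), agreeing on every compared row.
NOT CLAIMED: the sampling algorithm and the normalisation C of g₀; anything about ∫|I|²/g₀ (§IV.B.1: «we can not guarantee this for all
orders»); which branch / value a given Set V (word, insertion, s) takes (the cell's per-word tables, `tropical/view/V3-VOLKOV-DEGREES-
lit2-*.tsv`, are a Python reading of the same definitions, `pub-qed-trop-v3-lit-2/tools/v24deg0.py`, whose self-test is the same FIG. 2
list); graphs with lepton loops (M1); that (M2)'s identification holds beyond maximal forests; a formal bridge from (D)'s abstract intervals to
lit g21's Boolean `Gr.onePI` / `Gr.overlap` (the instance theorem checks FIG. 2 only).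
-/

namespace Literature.MathematicalPhysics.QuantumFieldTheory.Volkov2024

open Volkov2017

/-! ## Line sets of G′/F, path segments, 1- and 2-equivalence classes, ω̄ -/

/-- Connected classes of the vertices `vs` under the lines `ls` (union-find seeded with every vertex of `vs`; empty classes dropped).
[cite: Volkov2024, §IV.B.2 (tex l.603–608: "1-equivalent … 2-equivalent … classes of equivalence")] -/
def classesOn (vs : List ℕ) (ls : List Ln) : List (List ℕ) :=
  ((ls.map fun l => (l.a, l.b)).foldl mergeComp (vs.map fun v => [v])).filter fun c => decide (c ≠ [])

/-- s′ = s ∩ Edge[G′/F] as lines of G′/F ("we really apply it to the set s′ …"). [cite: Volkov2024, §IV.B.2 (tex l.575–577)] -/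
def sLinesD (G : Gr) (D : Der) (s : List ℕ) : List Ln := (G.linesOf D).filter fun l => decide (l.id ∈ s)

/-- LPath[G′/F]: the lepton lines of G′/F (no lepton loops: all of them). [cite: Volkov2024, §IV.B.1 (tex l.544)] -/
def lpathD (G : Gr) (D : Der) : List Ln := (G.linesOf D).filter fun l => l.el

/-- Edge[G′/F] ∖ LPath[G′/F]: the photon lines of G′/F. [cite: Volkov2024, §IV.B.2 (tex l.603)] -/
def photD (G : Gr) (D : Der) : List Ln := (G.linesOf D).filter fun l => !l.el

/-- Vertex(LPath[G′/F]). [cite: Volkov2024, §IV.B.2 (tex l.603)] -/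
def pathVertsD (G : Gr) (D : Der) : List ℕ := vertsOf (lpathD G D)

/-- I₁, …, I_l: the vertex sets of the maximal sub-paths of s ∩ LPath[G′/F] ("|I_j| ≥ 2 for any j"). [cite: Volkov2024, §IV.B.2 (tex l.597–598)] -/
def segsD (G : Gr) (D : Der) (s : List ℕ) : List (List ℕ) :=
  components ((lpathD G D).filter fun l => decide (l.id ∈ s))

/-- I₀ = Vertex(LPath) ∖ (I₁ ∪ … ∪ I_l). [cite: Volkov2024, §IV.B.2 (tex l.599–601)] -/
def seg0D (G : Gr) (D : Der) (s : List ℕ) : List ℕ :=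
  (pathVertsD G D).filter fun v => !((segsD G D s).any fun I => decide (v ∈ I))

/-- B₁, …, B_r: the 1-equivalence classes (paths in Edge[G′/F] ∖ LPath). [cite: Volkov2024, §IV.B.2 (tex l.603–604)] -/
def oneClassesD (G : Gr) (D : Der) : List (List ℕ) := classesOn (pathVertsD G D) (photD G D)

/-- The 2-equivalence classes (paths in s ∖ LPath). [cite: Volkov2024, §IV.B.2 (tex l.604–605)] -/
def twoClassesD (G : Gr) (D : Der) (s : List ℕ) : List (List ℕ) :=
  classesOn (pathVertsD G D) ((photD G D).filter fun l => decide (l.id ∈ s))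

/-- N_{jb}: "the number of equivalence classes in I_j ∩ B_b with respect to 2-equivalence (the number is 0 if the set is empty)".
[cite: Volkov2024, §IV.B.2 (tex l.605)] -/
def nClasses (two : List (List ℕ)) (I B : List ℕ) : ℕ :=
  (((I.filter fun v => decide (v ∈ B)).map fun v => two.findIdx fun c => decide (v ∈ c)).eraseDups).length

/-- a_{jb} = 1 if 0 < N_{jb} < Σ_i N_{ib}; ½ if 1 = N_{jb} = Σ_i N_{ib}; 0 otherwise. [cite: Volkov2024, §IV.B.2 (tex l.606–612)] -/
def aCoef (N tot : ℕ) : ℚ := if 0 < N ∧ N < tot then 1 else if N = 1 ∧ tot = 1 then 1 / 2 else 0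

/-- ω̄_{G′/F}(s) = 2·Loop(s′) − |s′| + ½|Lept(s′) ∖ LPath| + ½Σ_{j≥1}|I_j| + ½Σ_{j≥1}Σ_b N_{jb} − Σ_{j≥1}Σ_b a_{jb} − ½.
[cite: Volkov2024, §IV.B.2 (tex l.613–617)] -/
def omegaBar (G : Gr) (D : Der) (s : List ℕ) : ℚ :=
  let s' := sLinesD G D s
  let segs := segsD G D s
  let I0 := seg0D G D s
  let two := twoClassesD G D s
  let lpIds := (lpathD G D).map fun l => l.id
  let leptOff := (s'.filter fun l => l.el && !decide (l.id ∈ lpIds)).length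
  let bSum := ((oneClassesD G D).map fun B =>
      let tot := nClasses two I0 B + (segs.map fun I => nClasses two I B).sum
      (segs.map fun I => (nClasses two I B : ℚ) / 2 - aCoef (nClasses two I B) tot).sum).sum
  2 * (nLoops s' : ℚ) - (s'.length : ℚ) + (leptOff : ℚ) / 2 + ((segs.map fun I => I.length).sum : ℚ) / 2 + bSum - 1 / 2

/-! ## Children, chains, Ch -/

/-- The children of G′ in F ("maximal elements of F properly contained in G′"), as vertex intervals. [cite: Volkov2024, §IV.B.2 (tex l.573)] -/
def childrenI (I : ℕ × ℕ) (F : List (ℕ × ℕ)) : List (ℕ × ℕ) :=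
  let inside := F.filter fun J => decide (I.1 ≤ J.1) && decide (J.2 ≤ I.2) && decide (J ≠ I)
  inside.filter fun J => inside.all fun K => !(decide (K.1 ≤ J.1) && decide (J.2 ≤ K.2) && decide (K ≠ J))

/-- The self-energy children of G′ in F (no external photon). [cite: Volkov2024, §IV.B.2 (tex l.836–862)] -/
def seChildren (G : Gr) (I : ℕ × ℕ) (F : List (ℕ × ℕ)) : List (ℕ × ℕ) :=
  (childrenI I F).filter fun J => decide (G.nGamma J = 0)

/-- Maximal runs of abutting intervals ([p,q] abuts [q+1, r]) — the members G₁, …, G_n of the chains (M2).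
[cite: Volkov2024, §IV.B.2 (tex l.836–845 "maximal with respect to inclusion")] -/
def runs : List (ℕ × ℕ) → List (List (ℕ × ℕ))
  | [] => []
  | J :: Js =>
    match runs Js with
    | [] => [[J]]
    | [] :: rs => [J] :: rs
    | (K :: r) :: rs => if J.2 + 1 = K.1 then (J :: K :: r) :: rs else [J] :: (K :: r) :: rs

/-- The lepton line of G entering the path vertex p (if internal). [cite: Volkov2024, §IV.B.2 (tex l.840 "incident to at least one vertex")] -/
def inLine (G : Gr) (p : ℕ) : Option ℕ := (G.lines.find? fun l => l.el && decide (max l.a l.b = p)).map fun l => l.id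

/-- The lepton line of G leaving the path vertex q (if internal). [cite: Volkov2024, §IV.B.2 (tex l.840)] -/
def outLine (G : Gr) (q : ℕ) : Option ℕ := (G.lines.find? fun l => l.el && decide (min l.a l.b = q)).map fun l => l.id

/-- l₁, …, l_{n+1}: the lepton lines adjoining the members of a run (M2). [cite: Volkov2024, §IV.B.2 (tex l.836–845)] -/
def joinIds (G : Gr) (run : List (ℕ × ℕ)) : List ℕ :=
  match run with
  | [] => []
  | J :: _ => (inLine G J.1).toList ++ run.filterMap fun K => outLine G K.2

/-- Ch[G′,F] — each chain as (members G₁ … G_n, joining lines l₁ … l_{n+1}) (M2). [cite: Volkov2024, §IV.B.2 (tex l.862)] -/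
def chains (G : Gr) (I : ℕ × ℕ) (F : List (ℕ × ℕ)) : List (List (ℕ × ℕ) × List ℕ) :=
  (runs (seChildren G I F)).map fun r => (r, joinIds G r)

/-- f̄((l₁,G₁,…,l_{n+1}), s) = −n/2 if l₁, …, l_{n+1} ∈ s; 0 otherwise. [cite: Volkov2024, §IV.B.2 (tex l.896–900)] -/
def fBar (c : List (ℕ × ℕ) × List ℕ) (s : List ℕ) : ℚ :=
  if c.2.all fun i => decide (i ∈ s) then -(c.1.length : ℚ) / 2 else 0

/-- Ch_{G′,F}(s) = Σ_{c∈Ch[G′,F]} g(c,s) with g = f̄ (no lepton loops: leptonic chains on LPath, s cyclo-complete — M1).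
[cite: Volkov2024, §IV.B.2 (tex l.879–900)] -/
def ch (G : Gr) (I : ℕ × ℕ) (F : List (ℕ × ℕ)) (s : List ℕ) : ℚ := ((chains G I F).map fun c => fBar c s).sum

/-! ## ω̃, ω̃′, D_F's argument, the branch test, Deg₀ -/

/-- ω̃_{G′,F}(s) = max(ω̄_{G′/F}(s), ω_{G′/F}(s)) − Ch_{G′,F}(s) (the first printed case; always the case without lepton loops — M1).
[cite: Volkov2024, §IV.B.2 (tex l.1007–1012)] -/
def omegaTilde (G : Gr) (I : ℕ × ℕ) (F : List (ℕ × ℕ)) (s : List ℕ) : ℚ :=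
  max (omegaBar G (G.der I F) s) (G.omegaD (G.der I F) s) - ch G I F s

/-- The three TABLE V constants C_Sub[G′,s] can take without lepton loops: C_SubI(s) (vertexlike, external photon of G inside),
C_SubLSEOP(s) (lepton self-energy on LPath), C_SubVOP(s) (other vertexlike on LPath). [cite: Volkov2024, §IV.B.2 (tex l.1013–1030), Table V] -/
structure SubConsts where
  /-- C_SubI(s) -/
  cI : ℚ
  /-- C_SubLSEOP(s) -/
  cSE : ℚ
  /-- C_SubVOP(s) -/
  cVOP : ℚ

/-- TABLE V, column «cyclo-complete, on path» (the only column used without lepton loops): C_SubI = 0, C_SubLSEOP = 0, C_SubVOP = 0.085.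
[cite: Volkov2024, Table V (PDF p.19)] -/
def colPath : SubConsts := ⟨0, 0, 0.085⟩

/-- `colPath` is read off rows C_SubI(s), C_SubLSEOP(s), C_SubVOP(s) of the verbatim `tableV` (first cell of each). [cite: Volkov2024, Table V] -/
theorem colPath_eq_tableV :
    (tableV.map fun r => (r.name, r.ccPath)).take 5 =
      [("C_SubLSEOP(s)", some colPath.cSE), ("C_SubLSEOL(s)", some 0.021), ("C_SubI(s)", some colPath.cI),
       ("C_SubVOP(s)", some colPath.cVOP), ("C_SubVOL(s)", some 0.185)] := by
  rfl

/-- ω̃′_{G′,F}(s) = min(0, ω̃_{G′,F}(s) + C_Sub[G′,s]), the case split of C_Sub being `Gr.dSub` (I-type ↦ C_SubI, self-energy ↦ C_SubLSEOP,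
other vertexlike ↦ C_SubVOP). [cite: Volkov2024, §IV.B.2 (tex l.1012–1030)] -/
def omegaTilde' (G : Gr) (c : SubConsts) (I : ℕ × ℕ) (F : List (ℕ × ℕ)) (s : List ℕ) : ℚ :=
  min 0 (omegaTilde G I F s + G.dSub c.cI c.cSE c.cVOP I)

/-- X_F(s) := −Σ_{G′∈F} ω̃′_{G′,F}(s), the first argument of D_F(s) = τ(X_F(s), C_Add(s), C_Sat(s)). [cite: Volkov2024, §IV.B.3 (tex l.1152–1154)] -/
def dfArg (G : Gr) (c : SubConsts) (F : List (ℕ × ℕ)) (s : List ℕ) : ℚ :=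
  -((F.map fun I => omegaTilde' G c I F s).sum)

/-- The «big-set» branch test: Lept(Edge[G]) ⊆ s and ∃ F ∈ 𝔉_max[G] with ω̃_{G′,F}(s) ≥ 0 for all G′ ∈ F. [cite: Volkov2024, §IV.B.3 (tex l.1146–1149)] -/
def bigCase (G : Gr) (s : List ℕ) : Bool :=
  G.allElectrons s && G.maxForests.any fun F => F.all fun I => decide (0 ≤ omegaTilde G I F s)

/-- |Ph(s)| / |Ph(Edge[G])|. [cite: Volkov2024, §IV.B.3 (tex l.1146)] -/
def phFrac (G : Gr) (s : List ℕ) : ℚ :=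
  (((G.sub s).filter fun l => !l.el).length : ℚ) / ((G.lines.filter fun l => !l.el).length : ℚ)

/-- min_{F∈𝔉_max[G]} X_F(s) — the argument at which τ is evaluated off the big-set branch (`deg0_of_not_bigCase`). [cite: Volkov2024, §IV.B.3 (tex l.1150)] -/
def deg0Arg (G : Gr) (c : SubConsts) (s : List ℕ) : ℚ := lmin (G.maxForests.map fun F => dfArg G c F s)

/-- Minimum of a nonempty list of reals (0 on the empty list) — the printed "min_{F∈𝔉_max[G]}". [cite: Volkov2024, §IV.B.3 (tex l.1150)] -/
noncomputable def lminR : List ℝ → ℝ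
  | [] => 0
  | x :: xs => xs.foldl min x

/-- Deg₀(s) of PRD 110 §IV.B.3 for a graph without lepton loops: C_BigZ + (C_BigF − C_BigZ)·|Ph(s)|/|Ph(Edge[G])| on the big-set branch,
min_{F∈𝔉_max[G]} τ(−Σ_{G′∈F} ω̃′_{G′,F}(s), C_Add, C_Sat) otherwise (`bigBranch`, `tau` of the companion files).
[cite: Volkov2024, §IV.B.3 (tex l.1143–1163)] -/
noncomputable def deg0 (G : Gr) (c : SubConsts) (cbz cbf ca cs : ℝ) (s : List ℕ) : ℝ :=
  if bigCase G s then bigBranch cbz cbf (phFrac G s : ℝ)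
  else lminR (G.maxForests.map fun F => tau (dfArg G c F s : ℝ) ca cs)

/-- Deg₀ with the printed TABLE V column «cyclo-complete, on path» (every Set V graph): sub-constants `colPath`, C_BigZ = 0.695, C_BigF = 0.285,
C_Add = 0.199, C_Sat = 0.46. [cite: Volkov2024, §IV.B.3 + Table V] -/
noncomputable def deg0SetV (G : Gr) (s : List ℕ) : ℝ := deg0 G colPath (cBigZ 0) (cBigF 0) (cAdd 0) (cSat 0) s

/-! ## General facts: τ is increasing; −Σω̃′ ≥ 0; 𝔉_max ≠ ∅; min_F τ(X_F) = τ(min_F X_F); Deg₀ > 0 -/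

/-- μ(t) = 2 + t + √(t² + ¼) is strictly increasing (|√(a²+¼) − √(b²+¼)| < |a − b|). [cite: Volkov2024, §IV.B.3 (tex l.1163)] -/
theorem mu_strictMono : StrictMono mu := by
  intro a b hab
  unfold mu
  obtain ⟨ha, _⟩ := sqrt_sq_add_quarter_bounds a
  obtain ⟨hb, _⟩ := sqrt_sq_add_quarter_bounds b
  set A := Real.sqrt (a ^ 2 + 1 / 4) with hA
  set B := Real.sqrt (b ^ 2 + 1 / 4) with hB
  have hA2 : A ^ 2 = a ^ 2 + 1 / 4 := by rw [hA]; exact Real.sq_sqrt (by positivity)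
  have hB2 : B ^ 2 = b ^ 2 + 1 / 4 := by rw [hB]; exact Real.sq_sqrt (by positivity)
  have ha' : -a < A := lt_of_le_of_lt (neg_le_abs a) ha
  have hb' : -b < B := lt_of_le_of_lt (neg_le_abs b) hb
  have hb'' : b < B := lt_of_le_of_lt (le_abs_self b) hb
  by_contra h
  have h1 : b - a ≤ A - B := by linarith [not_lt.mp h]
  have hpos : 0 < A + B + a + b := by linarith
  nlinarith [mul_pos (sub_pos.2 hab) hpos, h1, hA2, hB2]

/-- τ(·, C_a, C_s) is strictly increasing in its first argument whenever C_a + C_s > 0 (true in every column of TABLE V, `tableV_CaCs_pos`).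
[cite: Volkov2024, §IV.B.3 (tex l.1159–1163)] -/
theorem tau_strictMono {ca cs : ℝ} (h : 0 < ca + cs) : StrictMono fun x => tau x ca cs := by
  intro x y hxy
  unfold tau
  have : (x - cs) / (ca + cs) < (y - cs) / (ca + cs) := div_lt_div_of_pos_right (by linarith) h
  have := mu_strictMono this
  nlinarith

/-- τ is monotone in its first argument (C_a + C_s > 0). [cite: Volkov2024, §IV.B.3] -/
theorem tau_mono {ca cs : ℝ} (h : 0 < ca + cs) : Monotone fun x => tau x ca cs := (tau_strictMono h).monotone

/-- ω̃′ ≤ 0. [cite: Volkov2024, §IV.B.2 (tex l.1012)] -/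
theorem omegaTilde'_nonpos (G : Gr) (c : SubConsts) (I : ℕ × ℕ) (F : List (ℕ × ℕ)) (s : List ℕ) : omegaTilde' G c I F s ≤ 0 :=
  min_le_left _ _

/-- X_F(s) = −Σ ω̃′ ≥ 0 for every forest and set. [cite: Volkov2024, §IV.B.3 (tex l.1152)] -/
theorem dfArg_nonneg (G : Gr) (c : SubConsts) (F : List (ℕ × ℕ)) (s : List ℕ) : 0 ≤ dfArg G c F s := by
  unfold dfArg
  rw [neg_nonneg]
  suffices h : ∀ l : List ℚ, (∀ x ∈ l, x ≤ 0) → l.sum ≤ 0 by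
    apply h
    intro x hx
    obtain ⟨I, _, rfl⟩ := List.mem_map.mp hx
    exact omegaTilde'_nonpos G c I F s
  intro l hl
  induction l with
  | nil => simp
  | cons x xs ih =>
    rw [List.sum_cons]
    exact add_nonpos (hl x (by simp)) (ih fun y hy => hl y (by simp [hy]))

/-- A `foldl min` over nonnegative rationals starting from a nonnegative one is nonnegative. [folklore] -/
private theorem foldl_min_nonneg (xs : List ℚ) (x : ℚ) (hx : 0 ≤ x) (h : ∀ y ∈ xs, 0 ≤ y) : 0 ≤ xs.foldl min x := by
  induction xs generalizing x with
  | nil => exact hx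
  | cons y ys ih =>
    exact ih (min x y) (le_min hx (h y (by simp))) (fun z hz => h z (by simp [hz]))

/-- min_F X_F(s) ≥ 0. [cite: Volkov2024, §IV.B.3] -/
theorem deg0Arg_nonneg (G : Gr) (c : SubConsts) (s : List ℕ) : 0 ≤ deg0Arg G c s := by
  unfold deg0Arg
  cases hl : (G.maxForests.map fun F => dfArg G c F s) with
  | nil => simp [lmin]
  | cons x xs =>
    have hall : ∀ y ∈ x :: xs, 0 ≤ y := by
      rw [← hl]; intro y hy; obtain ⟨F, _, rfl⟩ := List.mem_map.mp hy; exact dfArg_nonneg G c F s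
    exact foldl_min_nonneg xs x (hall x (by simp)) (fun y hy => hall y (by simp [hy]))

/-- 𝔉_max[G] is never empty in the model (the empty family of proper subgraphs is a forest; a longest forest is maximal).
[cite: Volkov2024, §IV.B.3 (tex l.1141)] -/
theorem maxForests_ne_nil (G : Gr) : G.maxForests ≠ [] := by
  intro h
  dsimp only [Gr.maxForests] at h
  set fs := G.uvSubs.sublists.filter (fun F => F.all fun I => F.all fun J => !G.overlap I J) with hfs
  have h0 : ([] : List (ℕ × ℕ)) ∈ fs := by
    rw [hfs, List.mem_filter]
    exact ⟨List.mem_sublists.mpr (List.nil_sublist _), by simp⟩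
  obtain ⟨M, hM, hmax⟩ := Finset.exists_max_image fs.toFinset List.length ⟨[], List.mem_toFinset.mpr h0⟩
  rw [List.mem_toFinset] at hM
  have hpass : (fs.all fun F' => !(M.all fun I => decide (I ∈ F')) || decide (F'.length ≤ M.length)) = true := by
    rw [List.all_eq_true]
    intro F' hF'
    have := hmax F' (List.mem_toFinset.mpr hF')
    simp [this]
  have hmem : G.top :: M ∈ (fs.filter fun F => fs.all fun F' =>
      !(F.all fun I => decide (I ∈ F')) || decide (F'.length ≤ F.length)).map (fun F => G.top :: F) :=
    List.mem_map.mpr ⟨M, List.mem_filter.mpr ⟨hM, hpass⟩, rfl⟩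
  rw [h] at hmem
  simp at hmem

/-- `foldl min` commutes with a monotone map. [folklore] -/
private theorem foldl_min_map_mono {f : ℚ → ℝ} (hf : Monotone f) (xs : List ℚ) (x : ℚ) :
    (xs.map f).foldl min (f x) = f (xs.foldl min x) := by
  induction xs generalizing x with
  | nil => rfl
  | cons y ys ih => simp only [List.map_cons, List.foldl_cons, ← hf.map_min, ih]

/-- For a nonempty list, the minimum of the monotone images is the image of the minimum. [folklore] -/
private theorem lminR_map_mono {f : ℚ → ℝ} (hf : Monotone f) {l : List ℚ} (hl : l ≠ []) : lminR (l.map f) = f (lmin l) := by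
  cases l with
  | nil => exact absurd rfl hl
  | cons x xs => exact foldl_min_map_mono hf xs x

/-- Off the big-set branch, Deg₀(s) = min_F τ(X_F(s), C_Add, C_Sat) = τ(min_F X_F(s), C_Add, C_Sat) (τ increasing, 𝔉_max ≠ ∅) — the step used
silently in the printed example «Since all the constants … are nonnegative, we have Deg₀(s) = τ(max(0, 1 − C_SubI(s)), …)».
[cite: Volkov2024, §IV.B.3 (tex l.1150–1163, l.1188–1191)] -/
theorem deg0_of_not_bigCase (G : Gr) (c : SubConsts) (cbz cbf : ℝ) {ca cs : ℝ} (hcs : 0 < ca + cs) (s : List ℕ)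
    (hb : bigCase G s = false) : deg0 G c cbz cbf ca cs s = tau (deg0Arg G c s : ℝ) ca cs := by
  unfold deg0 deg0Arg
  rw [hb, if_neg Bool.false_ne_true]
  have hmono : Monotone fun x : ℚ => tau (x : ℝ) ca cs := fun a b hab => tau_mono hcs (Rat.cast_le.mpr hab)
  have hne : (G.maxForests.map fun F => dfArg G c F s) ≠ [] := by
    simpa using maxForests_ne_nil G
  have key := lminR_map_mono hmono hne
  rw [List.map_map] at key
  exact key

/-- On the big-set branch, Deg₀(s) = C_BigZ + (C_BigF − C_BigZ)·|Ph(s)|/|Ph(Edge[G])|. [cite: Volkov2024, §IV.B.3 (tex l.1146–1149)] -/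
theorem deg0_of_bigCase (G : Gr) (c : SubConsts) (cbz cbf ca cs : ℝ) (s : List ℕ) (hb : bigCase G s = true) :
    deg0 G c cbz cbf ca cs s = cbz + (cbf - cbz) * (phFrac G s : ℝ) := by
  unfold deg0; rw [hb, if_pos rfl]; rfl

/-- 0 ≤ |Ph(s)|/|Ph(Edge[G])|. [cite: Volkov2024, §IV.B.3] -/
theorem phFrac_nonneg (G : Gr) (s : List ℕ) : 0 ≤ phFrac G s := by
  unfold phFrac; positivity

/-- |Ph(s)|/|Ph(Edge[G])| ≤ 1. [cite: Volkov2024, §IV.B.3] -/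
theorem phFrac_le_one (G : Gr) (s : List ℕ) : phFrac G s ≤ 1 := by
  unfold phFrac Gr.sub
  apply div_le_one_of_le₀ _ (by positivity)
  have h : ((G.lines.filter fun l => decide (l.id ∈ s)).filter fun l => !l.el).length ≤ (G.lines.filter fun l => !l.el).length :=
    (List.filter_sublist.filter _).length_le
  exact_mod_cast h

/-- Deg₀(s) > 0 for EVERY graph of the model and EVERY line set, with the printed TABLE V constants of either cyclo-complete column for the
big-set branch (`jz`) and of any column for D_F (`j`), and ANY sub-constants — §IV.A's «Deg₀(s) are arbitrary positive real numbers» holds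
by construction (V3b g6's `bigBranch_printed_pos`, `DF_pos` assembled with the recursion). [cite: Volkov2024, §IV.A, §IV.B.3, Table V] -/
theorem deg0_pos (G : Gr) (c : SubConsts) (jz : Fin 2) (j : Fin 4) (s : List ℕ) :
    0 < deg0 G c (cBigZ jz) (cBigF jz) (cAdd j) (cSat j) s := by
  cases hb : bigCase G s with
  | true =>
    rw [deg0_of_bigCase G c _ _ _ _ s hb]
    have h0 : (0 : ℝ) ≤ (phFrac G s : ℝ) := by exact_mod_cast phFrac_nonneg G s
    have h1 : (phFrac G s : ℝ) ≤ 1 := by exact_mod_cast phFrac_le_one G s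
    exact bigBranch_printed_pos jz _ h0 h1
  | false =>
    have hcs : (0 : ℝ) < (cAdd j : ℝ) + (cSat j : ℝ) := by exact_mod_cast tableV_CaCs_pos j
    rw [deg0_of_not_bigCase G c _ _ hcs s hb]
    exact DF_pos j _

/-- In particular the Set V exponent (column «cyclo-complete, on path») is positive on every graph and set. [cite: Volkov2024, §IV.A, §IV.B.3] -/
theorem deg0SetV_pos (G : Gr) (s : List ℕ) : 0 < deg0SetV G s := deg0_pos G colPath 0 0 s

/-! ## The printed no-lepton-loop example: FIG. 2 `fig_example_noloops` -/

/-- FIG. 2 of PRD 110: lepton path a…i (vertices 0…8), external photon at g = 6; lepton lines 1–8 = ab, bc, cd, de, ef, fg, gh, hi; photons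
9 = ce, 10 = df, 11 = bh, 12 = ai. [cite: Volkov2024, §IV.B.2 FIG. 2 (tex l.566–571)] -/
def figNoLoops : Gr := ⟨9, 6, [⟨1, true, 0, 1⟩, ⟨2, true, 1, 2⟩, ⟨3, true, 2, 3⟩, ⟨4, true, 3, 4⟩, ⟨5, true, 4, 5⟩, ⟨6, true, 5, 6⟩,
  ⟨7, true, 6, 7⟩, ⟨8, true, 7, 8⟩, ⟨9, false, 2, 4⟩, ⟨10, false, 3, 5⟩, ⟨11, false, 1, 7⟩, ⟨12, false, 0, 8⟩]⟩

/-- G₁ = bcdefgh = [1, 7]; G₂ = cdef, G₃ = cde, G₄ = def are the intervals `Volkov2017.cdef` = [2,5], `cde` = [2,4], `def_` = [3,5] (same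
vertex letters). [cite: Volkov2024, §IV.B.2 eq. (11) (tex l.580, l.1082)] -/
def bcdefgh : ℕ × ℕ := (1, 7)

/-- F₁ = {G, G₁, G₂, G₃} in the model's member order (G, G₁, G₃, G₂). [cite: Volkov2024, §IV.B.2 eq. (10) (tex l.1079)] -/
def nlF₁ : List (ℕ × ℕ) := [figNoLoops.top, bcdefgh, cde, cdef]

/-- F₂ = {G, G₁, G₂, G₄}. [cite: Volkov2024, §IV.B.2 eq. (10) (tex l.1079)] -/
def nlF₂ : List (ℕ × ℕ) := [figNoLoops.top, bcdefgh, cdef, def_]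

/-- "the UV-divergent subgraphs are G₁ = bcdefgh, G₂ = cdef, G₃ = cde, G₄ = def" (G₂ the lepton self-energy one, G₁ the I-type one containing the
external vertex g, G₃ / G₄ vertexlike and overlapping) and "𝔉_max[G] = {F₁, F₂}". [cite: Volkov2024, §IV.B.2 (tex l.579–584), §IV.B.3 (tex l.1180–1183)] -/
theorem figNoLoops_forests :
    figNoLoops.uvSubs = [bcdefgh, cde, cdef, def_] ∧ figNoLoops.seSubs = [cdef] ∧ figNoLoops.vxSubs = [bcdefgh, cde, def_] ∧
    figNoLoops.infraSubs = [bcdefgh] ∧ figNoLoops.overlap cde def_ = true ∧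
    figNoLoops.maxForests = [nlF₁, nlF₂] ∧
    childrenI figNoLoops.top nlF₁ = [bcdefgh] ∧ childrenI bcdefgh nlF₁ = [cdef] ∧ childrenI cdef nlF₁ = [cde] ∧ childrenI cdef nlF₂ = [def_] := by
  decide +kernel

/-- "ω_G({1,…,11}) = 6 − 11 + 4 = −1, ω_G({1,3,4,5,8,9,10,11,12}) = 6 − 9 + 2.5 = −0.5" and, for F = {G,G₁,G₂,G₃}, "ω_{G₁/F}({1,…,11}) =
ω_{G₁/F}({2,6,7,11}) = 2 − 4 + 1.5 = −0.5 (G₂ is the only child of G₁ in F)". [cite: Volkov2024, §IV.B.2 (tex l.562–567, l.585–593)] -/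
theorem figNoLoops_omega :
    figNoLoops.omega [1, 2, 3, 4, 5, 6, 7, 8, 9, 10, 11] = -1 ∧ figNoLoops.omega [1, 3, 4, 5, 8, 9, 10, 11, 12] = -1 / 2 ∧
    figNoLoops.idsOf (figNoLoops.der bcdefgh nlF₁) = [2, 6, 7, 11] ∧
    figNoLoops.omegaD (figNoLoops.der bcdefgh nlF₁) [1, 2, 3, 4, 5, 6, 7, 8, 9, 10, 11] = -1 / 2 := by
  decide +kernel

/-- s = {4,5,10,11}, forest F₁ = {G,G₁,G₂,G₃}: "ω̃_{G,F₁}(s) = 0", "(ω̄, ω)_{G₁/F₁} = (−1.5, −1), ω̃ = −1", "ω̄_{G₂/F₁} = 0.5, ω̃_{G₂,F₁} = 0.5",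
"(ω̄, ω)_{G₃/F₁} = (−1, −0.5), ω̃ = −0.5"; all Ch = 0 here (the chain (2, G₂, 6) of G₁ has 2, 6 ∉ s). Rows (ω̄, ω, Ch, ω̃) per member.
[cite: Volkov2024, §IV.B.2 (tex l.1083–1105)] -/
theorem figNoLoops_s1_F1 :
    (nlF₁.map fun I => (omegaBar figNoLoops (figNoLoops.der I nlF₁) [4, 5, 10, 11], figNoLoops.omegaD (figNoLoops.der I nlF₁) [4, 5, 10, 11],
        ch figNoLoops I nlF₁ [4, 5, 10, 11], omegaTilde figNoLoops I nlF₁ [4, 5, 10, 11])) =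
      [(-1 / 2, 0, 0, 0), (-3 / 2, -1, 0, -1), (-1, -1 / 2, 0, -1 / 2), (1 / 2, 1 / 2, 0, 1 / 2)] := by
  decide +kernel

/-- s = {4,5,10,11}, forest F₂ = {G,G₁,G₂,G₄}: "ω̃_{G,F₂}(s) = 0", "ω̃_{G₁,F₂}(s) = max(−1.5, −1) = −1", "ω̃_{G₂,F₂}(s) = max(−0.5, 0) = 0",
"ω̃_{G₄,F₂}(s) = max(0, 0) = 0". [cite: Volkov2024, §IV.B.2 (tex l.1083–1110)] -/
theorem figNoLoops_s1_F2 :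
    (nlF₂.map fun I => (omegaBar figNoLoops (figNoLoops.der I nlF₂) [4, 5, 10, 11], figNoLoops.omegaD (figNoLoops.der I nlF₂) [4, 5, 10, 11],
        ch figNoLoops I nlF₂ [4, 5, 10, 11], omegaTilde figNoLoops I nlF₂ [4, 5, 10, 11])) =
      [(-1 / 2, 0, 0, 0), (-3 / 2, -1, 0, -1), (-1 / 2, 0, 0, 0), (0, 0, 0, 0)] := by
  decide +kernel

/-- THE ONE PRINTED INTERMEDIATE NOT REPRODUCED (flagged, not adopted): the paper prints "ω̃_{G₂,F₁}(s) = max(ω̄_{G₂,F₁}(s), ω_{G₂,F₁}(s)) =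
max(0.5, −0.5) = 0.5" for s = {4,5,10,11}; in the model G₂/F₁ = cdef with its child cde shrunk has the lines 5 = ([cde], f) and 10 = ([cde], f),
s′ = {5, 10}, Loop(s′) = 1, so ω_{G₂/F₁}(s) = 2 − 2 + ½ = +½ (not −½); ω̄ = ½ and ω̃ = ½ as printed, so nothing downstream changes.
[cite: Volkov2024, §IV.B.2 (tex l.1095–1097)] -/
theorem figNoLoops_flagged_intermediate :
    figNoLoops.idsOf (figNoLoops.der cdef nlF₁) = [5, 10] ∧ nLoops (sLinesD figNoLoops (figNoLoops.der cdef nlF₁) [4, 5, 10, 11]) = 1 ∧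
    figNoLoops.omegaD (figNoLoops.der cdef nlF₁) [4, 5, 10, 11] = 1 / 2 ∧ omegaBar figNoLoops (figNoLoops.der cdef nlF₁) [4, 5, 10, 11] = 1 / 2 ∧
    omegaTilde figNoLoops cdef nlF₁ [4, 5, 10, 11] = 1 / 2 := by
  decide +kernel

/-- Ch[G₁,F] = {(2, G₂, 6)} for both maximal forests (G₂ = cdef the only self-energy child of G₁; G and G₂ have no self-energy children), with
f̄ = −½ exactly when 2, 6 ∈ s; and the 1-equivalence classes of Vertex(LPath[G₁/F₂]) = {[cdef]}, {g}, {b, h} (photon 11 = bh).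
[cite: Volkov2024, §IV.B.2 (tex l.862, l.896–900, l.603)] -/
theorem figNoLoops_chains :
    chains figNoLoops bcdefgh nlF₁ = [([cdef], [2, 6])] ∧ chains figNoLoops bcdefgh nlF₂ = [([cdef], [2, 6])] ∧
    chains figNoLoops figNoLoops.top nlF₁ = [] ∧ chains figNoLoops cdef nlF₁ = [] ∧ chains figNoLoops cdef nlF₂ = [] ∧
    ch figNoLoops bcdefgh nlF₂ [1, 2, 3, 4, 5, 6, 7, 8, 10] = -1 / 2 ∧ ch figNoLoops bcdefgh nlF₂ [4, 5, 10, 11] = 0 ∧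
    ch figNoLoops bcdefgh nlF₂ [2, 6] = -1 / 2 ∧ ch figNoLoops bcdefgh nlF₂ [2] = 0 ∧
    oneClassesD figNoLoops (figNoLoops.der bcdefgh nlF₂) = [[2], [6], [1, 7]] := by
  decide +kernel

/-- s = {4,5,10}: "ω̃_{G,F₂}(s) = ω̃_{G₁,F₂}(s) = ω̃_{G₂,F₂}(s) = ω̃_{G₄,F₂}(s) = 0" and "s does not contain Lept(Edge[G])"; for F₁ the row G₃ = cde
reads ω̃ = −½ and G₂ reads +½ (not printed; they make D_{F₁} ≥ D_{F₂}). [cite: Volkov2024, §IV.B.3 (tex l.1192–1198)] -/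
theorem figNoLoops_s2 :
    (nlF₂.map fun I => omegaTilde figNoLoops I nlF₂ [4, 5, 10]) = [0, 0, 0, 0] ∧
    (nlF₁.map fun I => omegaTilde figNoLoops I nlF₁ [4, 5, 10]) = [0, 0, -1 / 2, 1 / 2] ∧
    figNoLoops.allElectrons [4, 5, 10] = false ∧ bigCase figNoLoops [4, 5, 10] = false := by
  decide +kernel

/-- s = {1,…,8,10}: "ω̃_{G,F₂}(s) = 0, ω̃_{G₁,F₂}(s) = 0, ω̃_{G₂,F₂}(s) = 0.5, ω̃_{G₄,F₂}(s) = 0" — the G₁ zero needs the chain term: (ω̄, ω, Ch) =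
(−½, −3/2, −½) ⇒ max(−½, −3/2) − (−½) = 0; Lept(Edge[G]) ⊆ s and all ω̃ ≥ 0 ⇒ big-set branch with |Ph(s)|/|Ph(Edge[G])| = 1/4.
[cite: Volkov2024, §IV.B.3 (tex l.1199–1205)] -/
theorem figNoLoops_s3 :
    (nlF₂.map fun I => (omegaBar figNoLoops (figNoLoops.der I nlF₂) [1, 2, 3, 4, 5, 6, 7, 8, 10],
        figNoLoops.omegaD (figNoLoops.der I nlF₂) [1, 2, 3, 4, 5, 6, 7, 8, 10], ch figNoLoops I nlF₂ [1, 2, 3, 4, 5, 6, 7, 8, 10],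
        omegaTilde figNoLoops I nlF₂ [1, 2, 3, 4, 5, 6, 7, 8, 10])) =
      [(0, -1, 0, 0), (-1 / 2, -3 / 2, -1 / 2, 0), (1 / 2, -1 / 2, 0, 1 / 2), (0, 0, 0, 0)] ∧
    (nlF₁.map fun I => omegaTilde figNoLoops I nlF₁ [1, 2, 3, 4, 5, 6, 7, 8, 10]) = [0, 0, 0, 1 / 2] ∧
    figNoLoops.allElectrons [1, 2, 3, 4, 5, 6, 7, 8, 10] = true ∧ bigCase figNoLoops [1, 2, 3, 4, 5, 6, 7, 8, 10] = true ∧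
    phFrac figNoLoops [1, 2, 3, 4, 5, 6, 7, 8, 10] = 1 / 4 ∧
    bigCase figNoLoops [4, 5, 10, 11] = false ∧ figNoLoops.allElectrons [4, 5, 10, 11] = false := by
  decide +kernel

/-- C_Sub[G′,s] on the five subgraphs of FIG. 2 for arbitrary constants: G and G₁ = bcdefgh are I-type (contain g) ↦ C_SubI; G₂ = cdef is a lepton
self-energy ↦ C_SubLSEOP; G₃ = cde, G₄ = def are vertexlike off the external vertex ↦ C_SubVOP. [cite: Volkov2024, §IV.B.2 (tex l.1013–1030)] -/
theorem figNoLoops_cSub (a b d : ℚ) :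
    figNoLoops.dSub a b d figNoLoops.top = a ∧ figNoLoops.dSub a b d bcdefgh = a ∧ figNoLoops.dSub a b d cdef = b ∧
    figNoLoops.dSub a b d cde = d ∧ figNoLoops.dSub a b d def_ = d := by
  simp only [Gr.dSub]
  refine ⟨if_pos (by decide), if_pos (by decide), ?_, ?_, ?_⟩
  · rw [if_neg (by decide), if_pos (by decide)]
  · rw [if_neg (by decide), if_neg (by decide)]
  · rw [if_neg (by decide), if_neg (by decide)]

/-- With the printed column-1 constants (`colPath`): X_{F₁}({4,5,10,11}) = 1 + 0.415, X_{F₂}({4,5,10,11}) = 1 = min; X_{F₁}({4,5,10}) = 0.415,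
X_{F₂}({4,5,10}) = 0 = min; both X vanish at {1,…,8,10}. [cite: Volkov2024, §IV.B.3 (tex l.1184–1205) + Table V] -/
theorem figNoLoops_dfArg_colPath :
    dfArg figNoLoops colPath nlF₁ [4, 5, 10, 11] = 283 / 200 ∧ dfArg figNoLoops colPath nlF₂ [4, 5, 10, 11] = 1 ∧
    deg0Arg figNoLoops colPath [4, 5, 10, 11] = 1 ∧
    dfArg figNoLoops colPath nlF₁ [4, 5, 10] = 83 / 200 ∧ dfArg figNoLoops colPath nlF₂ [4, 5, 10] = 0 ∧
    deg0Arg figNoLoops colPath [4, 5, 10] = 0 ∧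
    dfArg figNoLoops colPath nlF₁ [1, 2, 3, 4, 5, 6, 7, 8, 10] = 0 ∧ dfArg figNoLoops colPath nlF₂ [1, 2, 3, 4, 5, 6, 7, 8, 10] = 0 := by
  decide +kernel

/-- −min(0, w) for the two shapes that occur: min(0, w) = 0 for w ≥ 0, and min(0, −t + x) = −max(0, t − x). [folklore] -/
private theorem min_zero_of_nonneg {w : ℚ} (h : 0 ≤ w) : min 0 w = 0 := min_eq_left h

/-- min(0, −t + x) = −max(0, t − x). [folklore] -/
private theorem min_zero_neg_add (t x : ℚ) : min 0 (-t + x) = -max 0 (t - x) := by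
  rcases le_total x t with h | h
  · rw [min_eq_right (by linarith), max_eq_right (by linarith)]; ring
  · rw [min_eq_left (by linarith), max_eq_left (by linarith)]; ring

/-- The ω̃ columns of `figNoLoops_s1_F1` / `figNoLoops_s1_F2` alone (s = {4,5,10,11}). [cite: Volkov2024, §IV.B.2 (tex l.1083–1110)] -/
theorem figNoLoops_s1_tilde :
    omegaTilde figNoLoops figNoLoops.top nlF₁ [4, 5, 10, 11] = 0 ∧ omegaTilde figNoLoops bcdefgh nlF₁ [4, 5, 10, 11] = -1 ∧
    omegaTilde figNoLoops cde nlF₁ [4, 5, 10, 11] = -1 / 2 ∧ omegaTilde figNoLoops cdef nlF₁ [4, 5, 10, 11] = 1 / 2 ∧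
    omegaTilde figNoLoops figNoLoops.top nlF₂ [4, 5, 10, 11] = 0 ∧ omegaTilde figNoLoops bcdefgh nlF₂ [4, 5, 10, 11] = -1 ∧
    omegaTilde figNoLoops cdef nlF₂ [4, 5, 10, 11] = 0 ∧ omegaTilde figNoLoops def_ nlF₂ [4, 5, 10, 11] = 0 := by
  decide +kernel

/-- The ω̃ values at s = {4,5,10} per member (cf. `figNoLoops_s2`). [cite: Volkov2024, §IV.B.3 (tex l.1192–1198)] -/
theorem figNoLoops_s2_tilde :
    omegaTilde figNoLoops figNoLoops.top nlF₁ [4, 5, 10] = 0 ∧ omegaTilde figNoLoops bcdefgh nlF₁ [4, 5, 10] = 0 ∧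
    omegaTilde figNoLoops cde nlF₁ [4, 5, 10] = -1 / 2 ∧ omegaTilde figNoLoops cdef nlF₁ [4, 5, 10] = 1 / 2 ∧
    omegaTilde figNoLoops figNoLoops.top nlF₂ [4, 5, 10] = 0 ∧ omegaTilde figNoLoops bcdefgh nlF₂ [4, 5, 10] = 0 ∧
    omegaTilde figNoLoops cdef nlF₂ [4, 5, 10] = 0 ∧ omegaTilde figNoLoops def_ nlF₂ [4, 5, 10] = 0 := by
  decide +kernel

/-- The printed symbolic step for s = {4,5,10,11} on F₁, for ARBITRARY nonnegative sub-constants: X_{F₁}(s) = max(0, 1 − C_SubI) + max(0, ½ − C_SubVOP)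
(ω̃′_{G} = min(0, 0 + C_SubI) = 0, ω̃′_{G₁} = min(0, −1 + C_SubI), ω̃′_{G₃,F₁} = min(0, −0.5 + C_SubVOP), ω̃′_{G₂,F₁} = min(0, 0.5 + C_SubLSEOP) = 0).
[cite: Volkov2024, §IV.B.3 (tex l.1184–1191)] -/
theorem figNoLoops_dfArg_s1_F1 (c : SubConsts) (hI : 0 ≤ c.cI) (hSE : 0 ≤ c.cSE) :
    dfArg figNoLoops c nlF₁ [4, 5, 10, 11] = max 0 (1 - c.cI) + max 0 (1 / 2 - c.cVOP) := by
  obtain ⟨a1, a2, a3, a4, -⟩ := figNoLoops_s1_tilde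
  obtain ⟨d0, d1, d2, d3, -⟩ := figNoLoops_cSub c.cI c.cSE c.cVOP
  show -(([figNoLoops.top, bcdefgh, cde, cdef].map fun I => omegaTilde' figNoLoops c I nlF₁ [4, 5, 10, 11]).sum) = _
  simp only [List.map_cons, List.map_nil, List.sum_cons, List.sum_nil, omegaTilde', a1, a2, a3, a4, d0, d1, d2, d3]
  rw [min_zero_of_nonneg (by linarith : (0 : ℚ) ≤ 0 + c.cI), min_zero_of_nonneg (by linarith : (0 : ℚ) ≤ 1 / 2 + c.cSE),
    min_zero_neg_add 1 c.cI, show (-1 / 2 + c.cVOP : ℚ) = -(1 / 2) + c.cVOP by ring, min_zero_neg_add (1 / 2) c.cVOP]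
  ring

/-- The same on F₂: X_{F₂}(s) = max(0, 1 − C_SubI) (ω̃′_{G₂,F₂} = min(0, C_SubLSEOP) = 0, ω̃′_{G₄,F₂} = min(0, C_SubVOP) = 0), hence
min_F X_F({4,5,10,11}) = max(0, 1 − C_SubI(s)). [cite: Volkov2024, §IV.B.3 (tex l.1184–1191)] -/
theorem figNoLoops_deg0Arg_s1 (c : SubConsts) (hI : 0 ≤ c.cI) (hSE : 0 ≤ c.cSE) (hVOP : 0 ≤ c.cVOP) :
    dfArg figNoLoops c nlF₂ [4, 5, 10, 11] = max 0 (1 - c.cI) ∧ deg0Arg figNoLoops c [4, 5, 10, 11] = max 0 (1 - c.cI) := by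
  obtain ⟨-, -, -, -, b1, b2, b3, b4⟩ := figNoLoops_s1_tilde
  obtain ⟨d0, d1, d2, -, d4⟩ := figNoLoops_cSub c.cI c.cSE c.cVOP
  have e2 : dfArg figNoLoops c nlF₂ [4, 5, 10, 11] = max 0 (1 - c.cI) := by
    show -(([figNoLoops.top, bcdefgh, cdef, def_].map fun I => omegaTilde' figNoLoops c I nlF₂ [4, 5, 10, 11]).sum) = _
    simp only [List.map_cons, List.map_nil, List.sum_cons, List.sum_nil, omegaTilde', b1, b2, b3, b4, d0, d1, d2, d4]
    rw [min_zero_of_nonneg (by linarith : (0 : ℚ) ≤ 0 + c.cI), min_zero_of_nonneg (by linarith : (0 : ℚ) ≤ 0 + c.cSE),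
      min_zero_of_nonneg (by linarith : (0 : ℚ) ≤ 0 + c.cVOP), min_zero_neg_add 1 c.cI]
    ring
  have hF : figNoLoops.maxForests = [nlF₁, nlF₂] := figNoLoops_forests.2.2.2.2.2.1
  refine ⟨e2, ?_⟩
  simp only [deg0Arg, hF, List.map_cons, List.map_nil, figNoLoops_dfArg_s1_F1 c hI hSE, e2, lmin, List.foldl_cons, List.foldl_nil]
  exact min_eq_right (le_add_of_nonneg_right (le_max_left _ _))

/-- s = {4,5,10} for arbitrary nonnegative sub-constants: X_{F₂}(s) = 0 (all four ω̃ vanish), X_{F₁}(s) = max(0, ½ − C_SubVOP) ≥ 0, so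
min_F X_F(s) = 0 = X_{F₂}(s) — "Deg₀(s) = D_{F₂}(s)". [cite: Volkov2024, §IV.B.3 (tex l.1192–1198)] -/
theorem figNoLoops_deg0Arg_s2 (c : SubConsts) (hI : 0 ≤ c.cI) (hSE : 0 ≤ c.cSE) (hVOP : 0 ≤ c.cVOP) :
    dfArg figNoLoops c nlF₂ [4, 5, 10] = 0 ∧ dfArg figNoLoops c nlF₁ [4, 5, 10] = max 0 (1 / 2 - c.cVOP) ∧
    deg0Arg figNoLoops c [4, 5, 10] = 0 := by
  obtain ⟨a1, a2, a3, a4, b1, b2, b3, b4⟩ := figNoLoops_s2_tilde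
  obtain ⟨d0, d1, d2, d3, d4⟩ := figNoLoops_cSub c.cI c.cSE c.cVOP
  have e2 : dfArg figNoLoops c nlF₂ [4, 5, 10] = 0 := by
    show -(([figNoLoops.top, bcdefgh, cdef, def_].map fun I => omegaTilde' figNoLoops c I nlF₂ [4, 5, 10]).sum) = _
    simp only [List.map_cons, List.map_nil, List.sum_cons, List.sum_nil, omegaTilde', b1, b2, b3, b4, d0, d1, d2, d4]
    rw [min_zero_of_nonneg (by linarith : (0 : ℚ) ≤ 0 + c.cI), min_zero_of_nonneg (by linarith : (0 : ℚ) ≤ 0 + c.cSE),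
      min_zero_of_nonneg (by linarith : (0 : ℚ) ≤ 0 + c.cVOP)]
    ring
  have e1 : dfArg figNoLoops c nlF₁ [4, 5, 10] = max 0 (1 / 2 - c.cVOP) := by
    show -(([figNoLoops.top, bcdefgh, cde, cdef].map fun I => omegaTilde' figNoLoops c I nlF₁ [4, 5, 10]).sum) = _
    simp only [List.map_cons, List.map_nil, List.sum_cons, List.sum_nil, omegaTilde', a1, a2, a3, a4, d0, d1, d2, d3]
    rw [min_zero_of_nonneg (by linarith : (0 : ℚ) ≤ 0 + c.cI), min_zero_of_nonneg (by linarith : (0 : ℚ) ≤ 1 / 2 + c.cSE),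
      show (-1 / 2 + c.cVOP : ℚ) = -(1 / 2) + c.cVOP by ring, min_zero_neg_add (1 / 2) c.cVOP]
    ring
  have hF : figNoLoops.maxForests = [nlF₁, nlF₂] := figNoLoops_forests.2.2.2.2.2.1
  refine ⟨e2, e1, ?_⟩
  simp only [deg0Arg, hF, List.map_cons, List.map_nil, e1, e2, lmin, List.foldl_cons, List.foldl_nil]
  exact min_eq_right (le_max_left _ _)

/-- AS PRINTED, s = {4,5,10,11}: "Deg₀(s) = τ(max(0, 1 − C_SubI(s)), C_Add(s), C_Sat(s))" — for every choice of nonnegative sub-constants, every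
C_BigZ, C_BigF and every C_Add + C_Sat > 0. [cite: Volkov2024, §IV.B.3 (tex l.1184–1191)] -/
theorem figNoLoops_deg0_s1 (c : SubConsts) (hI : 0 ≤ c.cI) (hSE : 0 ≤ c.cSE) (hVOP : 0 ≤ c.cVOP) (cbz cbf : ℝ) {ca cs : ℝ}
    (hcs : 0 < ca + cs) : deg0 figNoLoops c cbz cbf ca cs [4, 5, 10, 11] = tau (max 0 (1 - c.cI) : ℚ) ca cs := by
  rw [deg0_of_not_bigCase figNoLoops c cbz cbf hcs _ figNoLoops_s3.2.2.2.2.2.1, (figNoLoops_deg0Arg_s1 c hI hSE hVOP).2]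

/-- AS PRINTED, s = {4,5,10}: "we still use D_F, because s does not contain Lept(Edge[G]): Deg₀(s) = D_{F₂}(s) = τ(0, C_Add(s), C_Sat(s))".
[cite: Volkov2024, §IV.B.3 (tex l.1192–1198)] -/
theorem figNoLoops_deg0_s2 (c : SubConsts) (hI : 0 ≤ c.cI) (hSE : 0 ≤ c.cSE) (hVOP : 0 ≤ c.cVOP) (cbz cbf : ℝ) {ca cs : ℝ}
    (hcs : 0 < ca + cs) :
    deg0 figNoLoops c cbz cbf ca cs [4, 5, 10] = tau 0 ca cs ∧ tau (dfArg figNoLoops c nlF₂ [4, 5, 10] : ℚ) ca cs = tau 0 ca cs := by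
  obtain ⟨e2, _, e⟩ := figNoLoops_deg0Arg_s2 c hI hSE hVOP
  rw [deg0_of_not_bigCase figNoLoops c cbz cbf hcs _ figNoLoops_s2.2.2.2, e, e2]
  simp

/-- AS PRINTED, s = {1,…,8,10}: "Deg₀(s) = ¼ C_BigF + ¾ C_BigZ" (big-set branch, one of the four photons in s). [cite: Volkov2024, §IV.B.3 (tex l.1199–1205)] -/
theorem figNoLoops_deg0_s3 (c : SubConsts) (cbz cbf ca cs : ℝ) :
    deg0 figNoLoops c cbz cbf ca cs [1, 2, 3, 4, 5, 6, 7, 8, 10] = (1 / 4) * cbf + (3 / 4) * cbz := by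
  rw [deg0_of_bigCase figNoLoops c cbz cbf ca cs _ figNoLoops_s3.2.2.2.1, figNoLoops_s3.2.2.2.2.1]
  push_cast
  ring

/-- The three printed Deg₀ values of FIG. 2 with the TABLE V column-1 numbers: τ(1, 0.199, 0.46), τ(0, 0.199, 0.46) and ¼·0.285 + ¾·0.695 = 0.5925.
[cite: Volkov2024, §IV.B.3 + Table V] -/
theorem figNoLoops_deg0SetV :
    deg0SetV figNoLoops [4, 5, 10, 11] = tau 1 (cAdd 0) (cSat 0) ∧ deg0SetV figNoLoops [4, 5, 10] = tau 0 (cAdd 0) (cSat 0) ∧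
    deg0SetV figNoLoops [1, 2, 3, 4, 5, 6, 7, 8, 10] = 0.5925 := by
  have hcs : (0 : ℝ) < (cAdd 0 : ℝ) + (cSat 0 : ℝ) := by exact_mod_cast tableV_CaCs_pos 0
  have hc : 0 ≤ colPath.cI ∧ 0 ≤ colPath.cSE ∧ 0 ≤ colPath.cVOP := by simp only [colPath]; norm_num
  refine ⟨?_, ?_, ?_⟩
  · rw [deg0SetV, figNoLoops_deg0_s1 colPath hc.1 hc.2.1 hc.2.2 _ _ hcs]
    simp [colPath]
  · rw [deg0SetV]
    exact (figNoLoops_deg0_s2 colPath hc.1 hc.2.1 hc.2.2 _ _ hcs).1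
  · rw [deg0SetV, figNoLoops_deg0_s3]
    simp only [cBigF, cBigZ]
    norm_num

/-! ## Concordance with PRD 96 (2017) on its own example graphs: 2024's −Ch = 2017's SE-chain correction ω* − ω′ -/

/-- On PRD 96's FIG. 5 (`figChains`: self-energy subgraphs bc, de, gh, ij; 𝔉_max = {{G,bc,de,gh,ij}}) the 2024 chains of (G, F) are PRD 96's two
SE-chains 𝔖[G] = {{1,3,5},{6,8,10}} with members (bc, de), (gh, ij), n = 2 each, and −Ch_{G,F}(s) = ω*_{G/F}(s) − ω′_{G/F}(s) (= ½Σ(|s′|−1) over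
SE-chains s′ ⊆ s) on the printed sets: 2 at {1,3,5,6,8,10}, 1 at {1,3,5,8,10}, 0 at {1,5,8,10}; on FIG. 3 (`figSelect`: self-energy cdef, chain
(2, cdef, 9) = 𝔖[G] = {{2,9}}) −Ch_{G,F}({1,2,6,7,9}) = ½ = ω*_{G/F} − ω′_{G/F} for F = {G, cdef} (printed "+ 1/2"). The 2024 term enters as
ω̃ = max(ω̄, ω) − Ch, the 2017 one as ω* = ω′ + ½Σ(|s′|−1): same sign, same size on these sets.
[cite: Volkov2024, §IV.B.2 (tex l.836–900); Volkov2017, §III.B (l.681–735)] -/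
theorem chains_vs_seChains2017 :
    let F := [figChains.top, bc, de, gh, ij]
    figChains.maxForests = [F] ∧ chains figChains figChains.top F = [([bc, de], [1, 3, 5]), ([gh, ij], [6, 8, 10])] ∧
    figChains.seChains = [[1, 3, 5], [6, 8, 10]] ∧
    ch figChains figChains.top F [1, 3, 5, 6, 8, 10] = -2 ∧
    figChains.omegaStar (figChains.der figChains.top F) [1, 3, 5, 6, 8, 10] - figChains.omega' (figChains.der figChains.top F) [1, 3, 5, 6, 8, 10] = 2 ∧
    ch figChains figChains.top F [1, 3, 5, 8, 10] = -1 ∧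
    figChains.omegaStar figChains.whole [1, 3, 5, 8, 10] - figChains.omega' figChains.whole [1, 3, 5, 8, 10] = 1 ∧
    ch figChains figChains.top F [1, 5, 8, 10] = 0 ∧
    figChains.omegaStar figChains.whole [1, 5, 8, 10] - figChains.omega' figChains.whole [1, 5, 8, 10] = 0 ∧
    chains figSelect figSelect.top [figSelect.top, cde, cdef] = [([cdef], [2, 9])] ∧ figSelect.seChains = [[2, 9]] ∧
    ch figSelect figSelect.top [figSelect.top, cdef] [1, 2, 6, 7, 9] = -1 / 2 ∧
    figSelect.omegaStar (figSelect.der figSelect.top [figSelect.top, cdef]) [1, 2, 6, 7, 9] -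
      figSelect.omega' (figSelect.der figSelect.top [figSelect.top, cdef]) [1, 2, 6, 7, 9] = 1 / 2 := by
  decide +kernel

/-! ## (M2)'s structural facts, DERIVED from the printed definitions: on a lepton path with a photon pairing, a photon-closed block
(a self-energy subgraph: «contain all lines connecting the vertexes», no external photon) is never crossed by a one-particle-irreducible
interval, and a 1PI interval containing the lepton line joining two abutting photon-closed blocks contains both with margin

Abstract form (appended 2026-08-23 by seat V3b gen 7): vertices are natural numbers along the lepton path, `ph u v` says «there is a photon
line with ends u, v»; the interval [x, y] is 1PI («amputated», PRD 110 §III fn 2) iff every lepton line (c, c+1) inside it is bridged by a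
photon of the interval; [p, q] is photon-closed iff every photon with one end in [p, q] has both ends there. Two UV-divergent subgraphs
«overlap» (§IV.B.2, tex l.530) iff their line sets meet and neither contains the other — for vertex intervals carrying all lines between
their vertices this forces a crossing x < p ≤ y < q (or its mirror), which `noCross_left` / `noCross_right` exclude when [p, q] is
photon-closed; hence adding every self-energy subgraph to a forest of UV-divergent subgraphs keeps it a forest, so every MAXIMAL forest
contains every self-energy subgraph; and by `superinterval_margins` / `abutting_blocks_inside` the parent of a self-energy child in a forest
contains the joining line to an abutting self-energy subgraph and therefore that subgraph too, so (forests being nested-or-disjoint) abutting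
self-energy subgraphs have the same parent — the identification used in (M2) for F ∈ 𝔉_max[G]. -/

/-- NO CROSSING FROM THE LEFT: if [x, y] is 1PI (every cut c, x ≤ c < y, bridged by a photon x ≤ u ≤ c < v ≤ y) and [p, q] is photon-closed,
then x < p ≤ y < q is impossible (the cut (p−1, p) of [x, y] would be bridged by a photon landing in [p, y] ⊆ [p, q] from u < p).
[cite: Volkov2024, §III fn 2 («one-particle irreducible … amputated»), §IV.B.2 (tex l.530–534: overlapping subgraphs, forests); consequence derived here] -/
theorem noCross_left (ph : ℕ → ℕ → Prop) {x y p q : ℕ}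
    (hPI : ∀ c, x ≤ c → c < y → ∃ u v, ph u v ∧ x ≤ u ∧ u ≤ c ∧ c < v ∧ v ≤ y)
    (hcl : ∀ u v, ph u v → (p ≤ u ∧ u ≤ q ↔ p ≤ v ∧ v ≤ q))
    (h1 : x < p) (h2 : p ≤ y) (h3 : y < q) : False := by
  obtain ⟨u, v, huv, hxu, huc, hcv, hvy⟩ := hPI (p - 1) (by omega) (by omega)
  have hv : p ≤ v ∧ v ≤ q := ⟨by omega, by omega⟩
  have hu := (hcl u v huv).mpr hv
  omega

/-- NO CROSSING FROM THE RIGHT: p < x ≤ q < y is impossible likewise (the cut (q, q+1) of [x, y]). [cite: Volkov2024, §III fn 2, §IV.B.2 (tex l.530–534); consequence derived here] -/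
theorem noCross_right (ph : ℕ → ℕ → Prop) {x y p q : ℕ}
    (hPI : ∀ c, x ≤ c → c < y → ∃ u v, ph u v ∧ x ≤ u ∧ u ≤ c ∧ c < v ∧ v ≤ y)
    (hcl : ∀ u v, ph u v → (p ≤ u ∧ u ≤ q ↔ p ≤ v ∧ v ≤ q))
    (h1 : p < x) (h2 : x ≤ q) (h3 : q < y) : False := by
  obtain ⟨u, v, huv, hxu, huc, hcv, hvy⟩ := hPI q h2 h3
  have hu : p ≤ u ∧ u ≤ q := ⟨by omega, huc⟩
  have hv := (hcl u v huv).mp hu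
  omega

/-- STRICT MARGINS: a 1PI interval [x, y] containing a photon-closed block [p, q] (p ≤ q) properly contains it with margin on BOTH sides,
x < p and q < y (in particular the parent of a self-energy child in a forest contains both lepton lines adjoining the child).
[cite: Volkov2024, §III fn 2, §IV.B.2 (tex l.573: children); consequence derived here] -/
theorem superinterval_margins (ph : ℕ → ℕ → Prop) {x y p q : ℕ}
    (hPI : ∀ c, x ≤ c → c < y → ∃ u v, ph u v ∧ x ≤ u ∧ u ≤ c ∧ c < v ∧ v ≤ y)
    (hcl : ∀ u v, ph u v → (p ≤ u ∧ u ≤ q ↔ p ≤ v ∧ v ≤ q))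
    (hpq : p ≤ q) (hx : x ≤ p) (hy : q ≤ y) (hne : x ≠ p ∨ y ≠ q) : x < p ∧ q < y := by
  rcases Nat.lt_or_ge q y with hqy | hqy
  · -- q < y: the cut (q, q+1) is bridged from u ≤ q; u in the block would put v in the block
    obtain ⟨u, v, huv, hxu, huc, hcv, hvy⟩ := hPI q (by omega) hqy
    refine ⟨?_, hqy⟩
    by_contra hxp
    have hu : p ≤ u ∧ u ≤ q := ⟨by omega, huc⟩
    have hv := (hcl u v huv).mp hu
    omega
  · -- y = q, so x < p: the cut (p−1, p) is bridged into the block from u < p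
    have hyq : y = q := le_antisymm hqy hy
    have hxp : x < p := by omega
    obtain ⟨u, v, huv, hxu, huc, hcv, hvy⟩ := hPI (p - 1) (by omega) (by omega)
    have hv : p ≤ v ∧ v ≤ q := ⟨by omega, by omega⟩
    have hu := (hcl u v huv).mpr hv
    omega

/-- ABUTTING BLOCKS: if [p₁, q₁] and [q₁+1, q₂] are photon-closed and a 1PI interval [x, y] contains the joining lepton line (q₁, q₁+1), then
x < p₁ and q₂ < y — it contains both blocks (the bridging photon of that cut can start in neither block). With `superinterval_margins`:
in any forest containing two abutting self-energy subgraphs each one's parent contains the other, so they are children of the same element.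
[cite: Volkov2024, §IV.B.2 (tex l.573, l.836–862: children, chains); consequence derived here] -/
theorem abutting_blocks_inside (ph : ℕ → ℕ → Prop) {x y p₁ q₁ q₂ : ℕ}
    (hPI : ∀ c, x ≤ c → c < y → ∃ u v, ph u v ∧ x ≤ u ∧ u ≤ c ∧ c < v ∧ v ≤ y)
    (hcl₁ : ∀ u v, ph u v → (p₁ ≤ u ∧ u ≤ q₁ ↔ p₁ ≤ v ∧ v ≤ q₁))
    (hcl₂ : ∀ u v, ph u v → (q₁ + 1 ≤ u ∧ u ≤ q₂ ↔ q₁ + 1 ≤ v ∧ v ≤ q₂))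
    (hx : x ≤ q₁) (hy : q₁ < y) : x < p₁ ∧ q₂ < y := by
  obtain ⟨u, v, huv, hxu, huc, hcv, hvy⟩ := hPI q₁ hx hy
  constructor
  · by_contra h
    have hu : p₁ ≤ u ∧ u ≤ q₁ := ⟨by omega, huc⟩
    have hv := (hcl₁ u v huv).mp hu
    omega
  · by_contra h
    have hv : q₁ + 1 ≤ v ∧ v ≤ q₂ := ⟨by omega, by omega⟩
    have hu := (hcl₂ u v huv).mpr hv
    omega

/-- The two facts instantiated on FIG. 2 (by `decide`, through lit g21's Boolean tests): G₂ = cdef is the only self-energy subgraph, it overlaps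
none of the UV-divergent subgraphs and sits in BOTH maximal forests; its parent G₁ = bcdefgh contains both adjoining lepton lines 2 and 6.
[cite: Volkov2024, §IV.B.2 eqs. (10)–(11) (tex l.1078–1082)] -/
theorem figNoLoops_seBlock_facts :
    (figNoLoops.uvSubs.map fun J => figNoLoops.overlap cdef J) = [false, false, false, false] ∧
    (figNoLoops.maxForests.all fun F => decide (cdef ∈ F)) = true ∧
    childrenI bcdefgh nlF₁ = [cdef] ∧ childrenI bcdefgh nlF₂ = [cdef] ∧
    (2 ∈ figNoLoops.idsOf (figNoLoops.der bcdefgh nlF₁)) ∧ (6 ∈ figNoLoops.idsOf (figNoLoops.der bcdefgh nlF₁)) := by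
  decide +kernel

/-! ## Any self-energy word: the vertex graph G(w, k) of a q-type (no-lepton-loop) self-energy diagram with the external photon inserted in
its k-th lepton line, and a kernel cross-check of the cell's Python reading on AHKN's X086

(Appended 2026-08-23 by seat V3b gen 7.) A q-type self-energy diagram of order 2n is «one open lepton line with 2n vertices and n photon
lines», 1PI [AoyamaEtAl2006 §2]; writing its vertices along the lepton line as a WORD of 2n letters, equal letters = the two ends of one
photon (the cell's convention, V3 NOTES §B.7 / SCHEMES.md §D), the anomalous-magnetic-moment vertex graphs are obtained by inserting the
external photon vertex into one of the 2n − 1 internal lepton lines (AHKN's Ward–Takahashi-summed set; here one insertion k at a time, as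
PRD 110's integrand is per vertex graph). `ahknGraph w k` builds that graph in lit g21's `Gr` model: path positions 0 … 2n (the external
vertex at position k), lepton line i = (i−1, i) for i = 1 … 2n, photon of the m-th distinct letter (order of first occurrence) numbered
2n + 1 + m. On FIG. 2's own word this reproduces `figNoLoops` up to the photon numbering (`ahknGraph_fig2`). -/

/-- The vertex graph G(w, k): self-energy word `w` (2n letters, each exactly twice), external photon inserted into the k-th lepton line
(1 ≤ k ≤ 2n − 1). Lines: leptons 1 … 2n along the path 0 … 2n (external vertex = position k), photons 2n+1, 2n+2, … by first occurrence of
their letter. [cite: AoyamaEtAl2006, §2 (q-type diagrams: one open lepton line with 2n vertices and n photons); Volkov2024, §III (the 3213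
vertexlike graphs without lepton loops, one Feynman-parametric integrand each)] -/
def ahknGraph (w : String) (k : ℕ) : Gr :=
  let cs := w.toList.map Char.toNat
  let n2 := cs.length
  let pos : ℕ → ℕ := fun j => if j ≤ k then j - 1 else j
  let leptons := (List.range n2).map fun i => (⟨i + 1, true, i, i + 1⟩ : Ln)
  let letters := cs.eraseDups
  let photons := (List.range letters.length).map fun m =>
    let c := letters.getD m 0
    let occ := (List.range n2).filter fun i => cs.getD i 0 = c
    (⟨n2 + 1 + m, false, pos (occ.getD 0 0 + 1), pos (occ.getD 1 0 + 1)⟩ : Ln)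
  ⟨n2 + 1, k, leptons ++ photons⟩

/-- FIG. 2 of PRD 110 is the word `abcdcdba` with the external photon in lepton line 6 (fg): `ahknGraph "abcdcdba" 6` has the same vertices,
lepton lines and photon ends as `figNoLoops` (photons renumbered 9 = ai, 10 = bh, 11 = ce, 12 = df), hence the same 𝔉_max, and the three
printed Deg₀ cases come out the same: X = 1 off the big branch at {4,5,10,11} (here {4,5,12,10}), X = 0 at {4,5,10} (here {4,5,12}), big
branch with photon fraction ¼ at {1,…,8,10} (here {1,…,8,12}). [cite: Volkov2024, §IV.B.2 FIG. 2, §IV.B.3 (tex l.1180–1205)] -/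
theorem ahknGraph_fig2 :
    ((ahknGraph "abcdcdba" 6).lines.map fun l => (l.el, l.a, l.b)) =
      [(true, 0, 1), (true, 1, 2), (true, 2, 3), (true, 3, 4), (true, 4, 5), (true, 5, 6), (true, 6, 7), (true, 7, 8),
       (false, 0, 8), (false, 1, 7), (false, 2, 4), (false, 3, 5)] ∧
    (ahknGraph "abcdcdba" 6).maxForests = figNoLoops.maxForests ∧
    deg0Arg (ahknGraph "abcdcdba" 6) colPath [4, 5, 12, 10] = 1 ∧ bigCase (ahknGraph "abcdcdba" 6) [4, 5, 12, 10] = false ∧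
    deg0Arg (ahknGraph "abcdcdba" 6) colPath [4, 5, 12] = 0 ∧ bigCase (ahknGraph "abcdcdba" 6) [4, 5, 12] = false ∧
    bigCase (ahknGraph "abcdcdba" 6) [1, 2, 3, 4, 5, 6, 7, 8, 12] = true ∧ phFrac (ahknGraph "abcdcdba" 6) [1, 2, 3, 4, 5, 6, 7, 8, 12] = 1 / 4 := by
  decide +kernel

/-- KERNEL CROSS-CHECK OF THE CELL's PYTHON READING (V3 NOTES §B.15, `tropical/view/V3-DEG24-X086.tsv.gz`, tool `v24deg0.py`) on AHKN's
tenth-order self-energy diagram X086 = word `abaccdedbe` (second-order self-energy block cc, vertexlike block ded): with TABLE V column 1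
and the «tied» convention (a face containing the merged lepton line at the external vertex contains both of its halves k, k+1), the
τ-argument X = min_F(−Σω̃′) on the named Hepp faces, insertion k = 2 (external photon left of both blocks; line ids: leptons e₁ = 1,
e₂ = {2,3}, e_i = i+1 for i ≥ 3; photons a…e = 11…15): UV face of the self-energy block {e₄, c} ↦ X = 0 (Deg₀ = τ(0)); of the vertexlike
block {e₆, e₇, d} ↦ 0; the SE-chain face {e₃, e₄, e₅, c} (block plus both adjoining lepton lines, f̄ = −½) ↦ ½; single lepton lines
e₁ … e₉ ↦ ½, 1, ½, 0, ½, 0.415, 0.415, 0.415, 0.415 (0.415 = ½ − C_SubVOP from the block ded); single photons a … e ↦ 1, 1, 1, 0.915,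
0.915; and the all-lepton sets with the first j photons are on the big-set branch with photon fraction j/5 (Deg₀ = 0.695 − 0.082 j).
At k = 4 (external vertex inside cc, which becomes I-type) the three named faces all read X = 0. These, and the corresponding rows at k = 7
and the complements of single lepton lines (93 rows in all, session record), agree with the Python table to its printed four decimals —
a third implementation of the 2024 rule on the track's first CORE-8 word (exponents only; value-free).
[cite: Volkov2024, §IV.B.3 + Table V; AoyamaEtAl2006, §2] -/
theorem x086_named_faces :
    let G := ahknGraph "abaccdedbe" 2
    (G.seSubs = [(4, 5)] ∧ G.vxSubs = [(6, 8), (6, 10)] ∧ G.maxForests.length = 1) ∧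
    ([[5, 13], [7, 8, 14], [4, 5, 6, 13]].map fun s => deg0Arg G colPath s) = [0, 0, 1 / 2] ∧
    ([[1], [2, 3], [4], [5], [6], [7], [8], [9], [10]].map fun s => deg0Arg G colPath s) =
      [1 / 2, 1, 1 / 2, 0, 1 / 2, 83 / 200, 83 / 200, 83 / 200, 83 / 200] ∧
    ([[11], [12], [13], [14], [15]].map fun s => deg0Arg G colPath s) = [1, 1, 1, 183 / 200, 183 / 200] ∧
    ([0, 1, 2, 3, 4].map fun j => (bigCase G ([1, 2, 3, 4, 5, 6, 7, 8, 9, 10] ++ (List.range j).map (· + 11)),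
        phFrac G ([1, 2, 3, 4, 5, 6, 7, 8, 9, 10] ++ (List.range j).map (· + 11)))) =
      [(true, 0), (true, 1 / 5), (true, 2 / 5), (true, 3 / 5), (true, 4 / 5)] ∧
    (let G4 := ahknGraph "abaccdedbe" 4
     G4.seSubs = [] ∧ G4.infraSubs = [(3, 5)] ∧ ([[4, 5, 13], [7, 8, 14], [3, 4, 5, 6, 13]].map fun s => deg0Arg G4 colPath s) = [0, 0, 0]) := by
  decide +kernel

end Literature.MathematicalPhysics.QuantumFieldTheory.Volkov2024
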